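import Summits.AtomisticToContinuum.Crystallization.Theorems.OverbindingBudgetAffineTaylorCellSymmetry

/-!
# OverbindingBudget — Taylor-model cells for the far-window certificate, part 16/16 «Cover»

MODULE PLAN (lens-4 g68, at hand-2's landing-shape request of 2026-09-02T14:19Z, critic row 1199 (II)) of the VERIFIED g67 leaf
`OverbindingBudgetAffineTaylorCell.lean` (sha256 `dabedef39e0c5fd2…`, 4214 l, critic row 1196): this module = leaf l.3930–4211
(§12 (K4) cover soundness: box trees, leaf checks, cover_sound5, A4 kernel exercise (section Cover)), body VERBATIM except as listed in `MAP.md` — here: final `end <ns>` l.4214 is the part footer.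
Same namespace `…Theorems.OverbindingBudgetAffineTaylorCell` in all 16 parts (declaration names unchanged); the parts import each other
linearly.  No `sorry`, no `native_decide`, standard axioms; no instances/notation; scoped `set_option maxHeartbeats` with explicit bounds only.
-/

namespace Summit.AtomisticToContinuum.Crystallization.Theorems.OverbindingBudgetAffineTaylorCell

/-! ## §12 (K4) COVER SOUNDNESS: a binary box tree in the five Gram coordinates whose leaves lie in certified cells

The coverage layer of the campaign (NODE memo §4 (K4)): a region of the pinned chart (`G₀₀ = 1`, coordinates
`x = (G₀₁, G₀₂, G₁₁, G₁₂, G₂₂)`) is presented as a binary tree of axis-aligned rational boxes; each leaf is either contained in the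
parallelotope of a CERTIFIED cell (containment decided in `ℚ` through a supplied inverse `inv` of the cell's direction matrix,
`cellCovers`), or is discharged by an external hypothesis indexed by a tag (inadmissible boxes, the zone-II ball — (K5), g68).
`CTree.check_sound` is the generic induction; `cellLeaf_sound5`/`cellLeaf_sound4` turn a kernel verdict `check5 = true`/`check = true`
plus `cellCovers = true` into the certificate inequality at every real point of the box; `cover_sound5` assembles a whole tree. -/
section Cover

/-- Explicit five-term sum (kernel-friendly; no `Finset`). -/
def sum5 {α : Type} [Add α] (f : Fin 5 → α) : α := f 0 + f 1 + f 2 + f 3 + f 4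

/-- `sum5_add` (docstring added by the landing lane; see the module docstring). [formal bookkeeping] -/
theorem sum5_add (f g : Fin 5 → ℝ) : sum5 (fun i => f i + g i) = sum5 f + sum5 g := by
  simp only [sum5]; ring

/-- `abs_sum5_le` (docstring added by the landing lane; see the module docstring). [formal bookkeeping] -/
theorem abs_sum5_le (f : Fin 5 → ℝ) : |sum5 f| ≤ sum5 (fun i => |f i|) := by
  simp only [sum5]
  calc |f 0 + f 1 + f 2 + f 3 + f 4| ≤ |f 0 + f 1 + f 2 + f 3| + |f 4| := abs_add_le _ _
    _ ≤ |f 0 + f 1 + f 2| + |f 3| + |f 4| := by gcongr; exact abs_add_le _ _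
    _ ≤ |f 0 + f 1| + |f 2| + |f 3| + |f 4| := by gcongr; exact abs_add_le _ _
    _ ≤ |f 0| + |f 1| + |f 2| + |f 3| + |f 4| := by gcongr; exact abs_add_le _ _

/-- `sum5_cast` (docstring added by the landing lane; see the module docstring). [formal bookkeeping] -/
theorem sum5_cast (f : Fin 5 → ℚ) : ((sum5 f : ℚ) : ℝ) = sum5 (fun i => (f i : ℝ)) := by
  simp only [sum5]; push_cast; ring

/-- The five free Gram entries of a `QF0` / of the cell centre, and the half-widths, as vectors. -/
def QF0.vec (M : QF0) : Fin 5 → ℚ := ![M.a01, M.a02, M.a11, M.a12, M.a22]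
/-- `Cell.gvec` (docstring added by the landing lane; see the module docstring). [formal bookkeeping] -/
def Cell.gvec (C : Cell) : Fin 5 → ℚ := ![C.Gc.a01, C.Gc.a02, C.Gc.a11, C.Gc.a12, C.Gc.a22]
/-- `Cell.hvec` (docstring added by the landing lane; see the module docstring). [formal bookkeeping] -/
def Cell.hvec (C : Cell) : Fin 5 → ℚ := ![C.h1, C.h2, C.h3, C.h4, C.h5]
/-- The direction matrix `R` of a cell: column `j` = the vector of `M_j` (`x = g + R t`). -/
def Cell.mat (C : Cell) (i j : Fin 5) : ℚ :=
  (![C.dir.m1.vec, C.dir.m2.vec, C.dir.m3.vec, C.dir.m4.vec, C.dir.m5.vec] : Fin 5 → Fin 5 → ℚ) j i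

/-- `Cell.gramAt_vec` (docstring added by the landing lane; see the module docstring). [formal bookkeeping] -/
theorem Cell.gramAt_vec (C : Cell) (t : Fin 5 → ℝ) (i : Fin 5) :
    (![(C.gramAt (t 0) (t 1) (t 2) (t 3) (t 4)).a01, (C.gramAt (t 0) (t 1) (t 2) (t 3) (t 4)).a02,
       (C.gramAt (t 0) (t 1) (t 2) (t 3) (t 4)).a11, (C.gramAt (t 0) (t 1) (t 2) (t 3) (t 4)).a12,
       (C.gramAt (t 0) (t 1) (t 2) (t 3) (t 4)).a22] : Fin 5 → ℝ) i
      = (C.gvec i : ℝ) + sum5 (fun j => (C.mat i j : ℝ) * t j) := by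
  fin_cases i <;> simp [Cell.gramAt, Cell.gvec, Cell.mat, QF0.vec, sum5] <;> ring

/-- A rational box in the five Gram coordinates: centre and half-widths. -/
structure Box5 where
  c : Fin 5 → ℚ
  b : Fin 5 → ℚ

/-- The two halves of a box split along axis `i`. -/
def Box5.lower (X : Box5) (i : Fin 5) : Box5 :=
  ⟨Function.update X.c i (X.c i - X.b i / 2), Function.update X.b i (X.b i / 2)⟩
/-- `Box5.upper` (docstring added by the landing lane; see the module docstring). [formal bookkeeping] -/
def Box5.upper (X : Box5) (i : Fin 5) : Box5 :=
  ⟨Function.update X.c i (X.c i + X.b i / 2), Function.update X.b i (X.b i / 2)⟩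

/-- `Box5.mem_split` (docstring added by the landing lane; see the module docstring). [formal bookkeeping] -/
theorem Box5.mem_split (X : Box5) (i : Fin 5) (x : Fin 5 → ℝ) (hx : ∀ k, |x k - X.c k| ≤ X.b k) :
    (∀ k, |x k - (X.lower i).c k| ≤ (X.lower i).b k) ∨ (∀ k, |x k - (X.upper i).c k| ≤ (X.upper i).b k) := by
  have hi := hx i
  by_cases hle : x i ≤ X.c i
  · left
    intro k
    by_cases hk : k = i
    · subst hk
      simp only [Box5.lower, Function.update_self]
      push_cast
      rw [abs_le] at hi ⊢; constructor <;> linarith [hi.1, hi.2]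
    · simp only [Box5.lower, Function.update_of_ne hk]; exact hx k
  · right
    intro k
    by_cases hk : k = i
    · subst hk
      simp only [Box5.upper, Function.update_self]
      push_cast
      rw [abs_le] at hi ⊢; constructor <;> linarith [hi.1, hi.2]
    · simp only [Box5.upper, Function.update_of_ne hk]; exact hx k

/-- A cover tree: leaves are covered by cell number `k`, or discharged externally by tag `k`; nodes split along an axis. -/
inductive CTree where
  | cell (k : ℕ)
  | other (k : ℕ)
  | split (i : Fin 5) (l r : CTree)

/-- `CTree.check` (docstring added by the landing lane; see the module docstring). [formal bookkeeping] -/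
def CTree.check (leafOK otherOK : ℕ → Box5 → Bool) : CTree → Box5 → Bool
  | .cell k, X => leafOK k X
  | .other k, X => otherOK k X
  | .split i l r, X => CTree.check leafOK otherOK l (X.lower i) && CTree.check leafOK otherOK r (X.upper i)

/-- ★ Generic cover soundness: if every leaf is sound on its box, the checked tree is sound on the root box. -/
theorem CTree.check_sound (Good : (Fin 5 → ℝ) → Prop) (leafOK otherOK : ℕ → Box5 → Bool)
    (hleaf : ∀ k X, leafOK k X = true → ∀ x : Fin 5 → ℝ, (∀ i, |x i - X.c i| ≤ X.b i) → Good x)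
    (hother : ∀ k X, otherOK k X = true → ∀ x : Fin 5 → ℝ, (∀ i, |x i - X.c i| ≤ X.b i) → Good x) :
    ∀ (T : CTree) (X : Box5), T.check leafOK otherOK X = true → ∀ x : Fin 5 → ℝ, (∀ i, |x i - X.c i| ≤ X.b i) → Good x := by
  intro T
  induction T with
  | cell k => intro X h x hx; exact hleaf k X h x hx
  | other k => intro X h x hx; exact hother k X h x hx
  | split i l r ihlo ihhi =>
      intro X h x hx
      simp only [CTree.check, Bool.and_eq_true] at h
      rcases X.mem_split i x hx with hm | hm
      · exact ihlo _ h.1 x hm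
      · exact ihhi _ h.2 x hm

/-- The absolute Gram point with `G₀₀ = 1` and free entries `x`. -/
def gramPt (x : Fin 5 → ℝ) : SymR := ⟨1, x 0, x 1, x 2, x 3, x 4⟩

/-- CONTAINMENT CHECK (exact, in `ℚ`): the box `X` lies in the parallelotope of the cell `C` — `C` is pinned (`G₀₀ = 1`), `inv` is a
right inverse of the direction matrix (`R·inv = 1`), and for every `j`: `Σ_i |inv_ji| b_i + |Σ_i inv_ji (c_i − g_i)| ≤ h_j`. -/
def cellCovers (C : Cell) (inv : Fin 5 → Fin 5 → ℚ) (X : Box5) : Bool :=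
  decide (C.Gc.a00 = 1 ∧
    (∀ i k : Fin 5, sum5 (fun j => C.mat i j * inv j k) = if i = k then 1 else 0) ∧
    (∀ j : Fin 5, sum5 (fun i => |inv j i| * X.b i) + |sum5 (fun i => inv j i * (X.c i - C.gvec i))| ≤ C.hvec j))

/-- `sum5_delta` (docstring added by the landing lane; see the module docstring). [formal bookkeeping] -/
theorem sum5_delta (i : Fin 5) (y : Fin 5 → ℝ) :
    sum5 (fun k => (((if i = k then 1 else 0 : ℚ)) : ℝ) * y k) = y i := by
  fin_cases i <;> simp [sum5]

/-- Containment soundness: every real point of the box is `g + R t` with `|t_j| ≤ h_j`, and the cell's Gram point there is `gramPt x`. -/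
theorem cellCovers_sound (C : Cell) (inv : Fin 5 → Fin 5 → ℚ) (X : Box5) (h : cellCovers C inv X = true)
    (x : Fin 5 → ℝ) (hx : ∀ i, |x i - X.c i| ≤ X.b i) :
    ∃ t : Fin 5 → ℝ, (∀ j, |t j| ≤ C.hvec j) ∧ C.gramAt (t 0) (t 1) (t 2) (t 3) (t 4) = gramPt x := by
  have hc := of_decide_eq_true h
  obtain ⟨h00, hinv, hwid⟩ := hc
  refine ⟨fun j => sum5 (fun i => (inv j i : ℝ) * (x i - C.gvec i)), ?_, ?_⟩
  · intro j
    beta_reduce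
    have hsplit : sum5 (fun i => (inv j i : ℝ) * (x i - C.gvec i))
        = sum5 (fun i => (inv j i : ℝ) * (x i - X.c i)) + sum5 (fun i => (inv j i : ℝ) * (X.c i - C.gvec i)) := by
      rw [← sum5_add]; congr 1; funext i; ring
    rw [hsplit]
    have h1 : |sum5 (fun i => (inv j i : ℝ) * (x i - X.c i))| ≤ sum5 (fun i => (|inv j i| : ℝ) * X.b i) := by
      refine (abs_sum5_le _).trans ?_
      simp only [sum5, abs_mul]
      have := fun i => mul_le_mul_of_nonneg_left (hx i) (abs_nonneg (inv j i : ℝ))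
      linarith [this 0, this 1, this 2, this 3, this 4]
    have h2 := hwid j
    have h2' : sum5 (fun i => (|inv j i| : ℝ) * X.b i) + |sum5 (fun i => (inv j i : ℝ) * (X.c i - C.gvec i))|
        ≤ (C.hvec j : ℝ) := by
      have hc' : ((sum5 (fun i => |inv j i| * X.b i) + |sum5 (fun i => inv j i * (X.c i - C.gvec i))| : ℚ) : ℝ)
          ≤ (C.hvec j : ℝ) := by exact_mod_cast h2
      have e1 : ((sum5 (fun i => |inv j i| * X.b i) : ℚ) : ℝ) = sum5 (fun i => (|inv j i| : ℝ) * X.b i) := by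
        simp only [sum5]; push_cast; rfl
      have e2 : ((sum5 (fun i => inv j i * (X.c i - C.gvec i)) : ℚ) : ℝ)
          = sum5 (fun i => (inv j i : ℝ) * (X.c i - C.gvec i)) := by
        simp only [sum5]; push_cast; rfl
      have e3 : ((sum5 (fun i => |inv j i| * X.b i) + |sum5 (fun i => inv j i * (X.c i - C.gvec i))| : ℚ) : ℝ)
          = sum5 (fun i => (|inv j i| : ℝ) * X.b i) + |sum5 (fun i => (inv j i : ℝ) * (X.c i - C.gvec i))| := by
        rw [Rat.cast_add, Rat.cast_abs, e1, e2]
      linarith [hc', e3]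
    calc |sum5 (fun i => (inv j i : ℝ) * (x i - X.c i)) + sum5 (fun i => (inv j i : ℝ) * (X.c i - C.gvec i))|
        ≤ |sum5 (fun i => (inv j i : ℝ) * (x i - X.c i))| + |sum5 (fun i => (inv j i : ℝ) * (X.c i - C.gvec i))| :=
          abs_add_le _ _
      _ ≤ _ := by linarith [h1, h2']
  · -- the Gram point: g_i + Σ_j R_ij t_j = x_i, from R·inv = 1
    have key : ∀ i : Fin 5, (C.gvec i : ℝ) + sum5 (fun j => (C.mat i j : ℝ) * sum5 (fun k => (inv j k : ℝ) * (x k - C.gvec k)))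
        = x i := by
      intro i
      have hswap : sum5 (fun j => (C.mat i j : ℝ) * sum5 (fun k => (inv j k : ℝ) * (x k - C.gvec k)))
          = sum5 (fun k => sum5 (fun j => (C.mat i j : ℝ) * inv j k) * (x k - C.gvec k)) := by
        simp only [sum5]; ring
      have hδ : ∀ k, sum5 (fun j => (C.mat i j : ℝ) * inv j k) = (((if i = k then 1 else 0 : ℚ)) : ℝ) := by
        intro k; have := hinv i k; rw [← this, sum5_cast]; push_cast; rfl
      rw [hswap]
      have : sum5 (fun k => sum5 (fun j => (C.mat i j : ℝ) * inv j k) * (x k - C.gvec k))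
          = sum5 (fun k => (((if i = k then 1 else 0 : ℚ)) : ℝ) * (x k - C.gvec k)) := by
        congr 1; funext k; rw [hδ k]
      rw [this, sum5_delta]; ring
    have hv := C.gramAt_vec (fun j => sum5 (fun i => (inv j i : ℝ) * (x i - C.gvec i)))
    have e0 := hv 0; have e1 := hv 1; have e2 := hv 2; have e3 := hv 3; have e4 := hv 4
    simp only [Matrix.cons_val_zero, Matrix.cons_val_one, Matrix.cons_val] at e0 e1 e2 e3 e4
    have k0 := key 0; have k1 := key 1; have k2 := key 2; have k3 := key 3; have k4 := key 4
    cases hG : C.gramAt (sum5 fun i => (inv 0 i : ℝ) * (x i - C.gvec i)) (sum5 fun i => (inv 1 i : ℝ) * (x i - C.gvec i))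
        (sum5 fun i => (inv 2 i : ℝ) * (x i - C.gvec i)) (sum5 fun i => (inv 3 i : ℝ) * (x i - C.gvec i))
        (sum5 fun i => (inv 4 i : ℝ) * (x i - C.gvec i)) with
    | mk a00 a01 a02 a11 a12 a22 =>
      have ha00 : a00 = 1 := by
        have := congrArg SymR.a00 hG; simp [Cell.gramAt] at this; rw [← this]; exact_mod_cast h00
      rw [hG] at e0 e1 e2 e3 e4
      simp only [gramPt]
      simp only at e0 e1 e2 e3 e4
      congr 1 <;> linarith [e0, e1, e2, e3, e4, k0, k1, k2, k3, k4]

/-- ★ A certified ORDER-5 cell covering the box gives the certificate inequality at every real point of the box. -/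
theorem cellLeaf_sound5 (R : CertRow) (hR : R.check5 hcpVecs = true) (inv : Fin 5 → Fin 5 → ℚ) (X : Box5)
    (hcov : cellCovers R.C inv X = true) (x : Fin 5 → ℝ) (hx : ∀ i, |x i - X.c i| ≤ X.b i)
    (far3 far6 : ℝ) (hf3 : 0 ≤ far3) (hf3' : far3 ≤ R.F6hi) (hf6 : (R.F12lo : ℝ) ≤ far6) :
    (R.B : ℝ) * (gramSum 3 hcpVecs (gramPt x) + far3) ^ 2 ≤ (R.A : ℝ) * (gramSum 6 hcpVecs (gramPt x) + far6) := by
  obtain ⟨t, ht, hG⟩ := cellCovers_sound R.C inv X hcov x hx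
  have h := R.check5_sound hcpVecs hR (t 0) (t 1) (t 2) (t 3) (t 4)
    (by simpa [Cell.hvec] using ht 0) (by simpa [Cell.hvec] using ht 1) (by simpa [Cell.hvec] using ht 2)
    (by simpa [Cell.hvec] using ht 3) (by simpa [Cell.hvec] using ht 4) far3 far6 hf3 hf3' hf6
  rw [Cell.trueSum_eq_gramSum, Cell.trueSum_eq_gramSum, hG] at h
  exact h

/-- The ORDER-4 variant. -/
theorem cellLeaf_sound4 (R : CertRow) (hR : R.check hcpVecs = true) (inv : Fin 5 → Fin 5 → ℚ) (X : Box5)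
    (hcov : cellCovers R.C inv X = true) (x : Fin 5 → ℝ) (hx : ∀ i, |x i - X.c i| ≤ X.b i)
    (far3 far6 : ℝ) (hf3 : 0 ≤ far3) (hf3' : far3 ≤ R.F6hi) (hf6 : (R.F12lo : ℝ) ≤ far6) :
    (R.B : ℝ) * (gramSum 3 hcpVecs (gramPt x) + far3) ^ 2 ≤ (R.A : ℝ) * (gramSum 6 hcpVecs (gramPt x) + far6) := by
  obtain ⟨t, ht, hG⟩ := cellCovers_sound R.C inv X hcov x hx
  have h := R.check_sound hcpVecs hR (t 0) (t 1) (t 2) (t 3) (t 4)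
    (by simpa [Cell.hvec] using ht 0) (by simpa [Cell.hvec] using ht 1) (by simpa [Cell.hvec] using ht 2)
    (by simpa [Cell.hvec] using ht 3) (by simpa [Cell.hvec] using ht 4) far3 far6 hf3 hf3' hf6
  rw [Cell.trueSum_eq_gramSum, Cell.trueSum_eq_gramSum, hG] at h
  exact h

/-- A campaign table entry: a row, the inverse of its direction matrix, and its kernel verdict as a field to be checked. -/
structure CellEntry where
  R : CertRow
  inv : Fin 5 → Fin 5 → ℚ

/-- Leaf check of a campaign: cell `k` exists, carries the campaign constants `(A, B, F₆⁺, F₁₂⁻)`, and covers the box. -/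
def leafOK5 (cells : List CellEntry) (A B F6hi F12lo : ℚ) (k : ℕ) (X : Box5) : Bool :=
  match cells[k]? with
  | none => false
  | some e => decide (e.R.A = A ∧ e.R.B = B ∧ e.R.F6hi = F6hi ∧ e.R.F12lo = F12lo) && cellCovers e.R.C e.inv X

/-- ★★ COVER SOUNDNESS (order 5): if every cell of the table is kernel-certified (`check5 = true`), every `other` leaf is discharged
by the external hypothesis, and the tree checks on the root box, then the certificate inequality holds at EVERY real Gram point of
the root box (pinned chart), for all far-field values `0 ≤ far₃ ≤ F₆⁺`, `far₆ ≥ F₁₂⁻`. -/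
theorem cover_sound5 (cells : List CellEntry) (A B F6hi F12lo : ℚ)
    (hcert : ∀ e ∈ cells, e.R.check5 hcpVecs = true)
    (otherOK : ℕ → Box5 → Bool)
    (hother : ∀ k X, otherOK k X = true → ∀ x : Fin 5 → ℝ, (∀ i, |x i - X.c i| ≤ X.b i) →
      ∀ far3 far6 : ℝ, 0 ≤ far3 → far3 ≤ F6hi → (F12lo : ℝ) ≤ far6 →
        (B : ℝ) * (gramSum 3 hcpVecs (gramPt x) + far3) ^ 2 ≤ (A : ℝ) * (gramSum 6 hcpVecs (gramPt x) + far6))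
    (T : CTree) (X0 : Box5) (hT : T.check (leafOK5 cells A B F6hi F12lo) otherOK X0 = true)
    (x : Fin 5 → ℝ) (hx : ∀ i, |x i - X0.c i| ≤ X0.b i)
    (far3 far6 : ℝ) (hf3 : 0 ≤ far3) (hf3' : far3 ≤ F6hi) (hf6 : (F12lo : ℝ) ≤ far6) :
    (B : ℝ) * (gramSum 3 hcpVecs (gramPt x) + far3) ^ 2 ≤ (A : ℝ) * (gramSum 6 hcpVecs (gramPt x) + far6) := by
  refine CTree.check_sound (fun x => ∀ far3 far6 : ℝ, 0 ≤ far3 → far3 ≤ F6hi → (F12lo : ℝ) ≤ far6 →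
        (B : ℝ) * (gramSum 3 hcpVecs (gramPt x) + far3) ^ 2 ≤ (A : ℝ) * (gramSum 6 hcpVecs (gramPt x) + far6))
    (leafOK5 cells A B F6hi F12lo) otherOK ?_ hother T X0 hT x hx far3 far6 hf3 hf3' hf6
  intro k X hk y hy f3 f6 h3 h3' h6
  unfold leafOK5 at hk
  cases hget : cells[k]? with
  | none => rw [hget] at hk; exact absurd hk (by simp)
  | some e =>
    rw [hget] at hk
    simp only [Bool.and_eq_true, decide_eq_true_eq] at hk
    obtain ⟨⟨hA, hB, hF6, hF12⟩, hcov⟩ := hk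
    have he : e ∈ cells := List.mem_of_getElem? hget
    have := cellLeaf_sound5 e.R (hcert e he) e.inv X hcov y hy f3 f6 h3 (by rw [hF6]; exact h3') (by rw [hF12]; exact h6)
    rw [hA, hB] at this
    exact this

/-! ### Kernel exercise of the cover check on the `A4z5` cell of the probes

`cellA4` is the `ℚ` cell of `probes/TCcertKernelA4z5.lean` (`ZA4.toCell`: centre `(600,324,8,648,−12,376)/600`, integer direction
matrix with columns `(4,16,6,−16,−20), (237,−16,−6,16,20), (−16,177,−24,64,80), (−3,−12,116,12,15), (16,64,24,177,−80)`, half-widths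
`(1/1800, 1/11850, 1/8850, 1/5800, 1/8850)`); `invA4` is the exact inverse of its direction matrix (denominators ≤ 1205).  The tree
below (two splits, three leaves, all covered by cell 0) over the box of half-width `1/232` around the centre CHECKS in the kernel; with
the probe file's verdict `RA4_checked' : RA4.check5 hcpVecs = true` as `hcert`, `cover_sound5` then yields the certificate inequality on
that box.  (The campaign's trees have 10³–10⁴ leaves per class; the check is linear in the number of nodes.) -/

/-- `cellA4` (docstring added by the landing lane; see the module docstring). [formal bookkeeping] -/
def cellA4 : Cell :=
  { m := 0, J := 5, Gc := ⟨1, (324 : ℚ) / 600, (8 : ℚ) / 600, (648 : ℚ) / 600, (-12 : ℚ) / 600, (376 : ℚ) / 600⟩,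
    h1 := 1 / 1800, h2 := 1 / 11850, h3 := 1 / 8850, h4 := 1 / 5800, h5 := 1 / 8850, D := 10 ^ 18,
    dir := { m1 := ⟨4, 16, 6, -16, -20⟩, m2 := ⟨237, -16, -6, 16, 20⟩, m3 := ⟨-16, 177, -24, 64, 80⟩,
             m4 := ⟨-3, -12, 116, 12, 15⟩, m5 := ⟨16, 64, 24, 177, -80⟩ } }

/-- `invA4` (docstring added by the landing lane; see the module docstring). [formal bookkeeping] -/
def invA4 : Fin 5 → Fin 5 → ℚ :=
  ![![(1 : ℚ) / 241, (4 : ℚ) / 241, (3 : ℚ) / 482, (-4 : ℚ) / 241, (-5 : ℚ) / 241],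
    ![(1 : ℚ) / 241, 0, 0, 0, (1 : ℚ) / 1205],
    ![0, (1 : ℚ) / 241, 0, 0, (4 : ℚ) / 1205],
    ![0, 0, (2 : ℚ) / 241, 0, (3 : ℚ) / 1205],
    ![0, 0, 0, (1 : ℚ) / 241, (-4 : ℚ) / 1205]]

/-- The row shell around `cellA4` with the campaign constants (the `LDLᵀ` certificate is irrelevant for the cover check). -/
def rowA4x : CertRow :=
  { C := cellA4, A := 2089 / 10, B := 1213 / 100, F6hi := 183 / 5000, F12lo := 0, P := ⟨0, 0, 0, 0, 0, 0, 0, 0, 0, 0, 0, 0, 0, 0, 0⟩ }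

/-- `boxA4` (docstring added by the landing lane; see the module docstring). [formal bookkeeping] -/
def boxA4 : Box5 :=
  ⟨![(324 : ℚ) / 600, (8 : ℚ) / 600, (648 : ℚ) / 600, (-12 : ℚ) / 600, (376 : ℚ) / 600],
   ![(1 : ℚ) / 232, (1 : ℚ) / 232, (1 : ℚ) / 232, (1 : ℚ) / 232, (1 : ℚ) / 232]⟩

/-- `treeA4` (docstring added by the landing lane; see the module docstring). [formal bookkeeping] -/
def treeA4 : CTree := .split 0 (.cell 0) (.split 3 (.cell 0) (.cell 0))

/-- `R·inv = 1` and the three leaf boxes lie in the parallelotope: decided in the kernel. -/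
theorem treeA4_check :
    treeA4.check (leafOK5 [⟨rowA4x, invA4⟩] (2089 / 10) (1213 / 100) (183 / 5000) 0) (fun _ _ => false) boxA4 = true := by
  decide +kernel


end Cover

end Summit.AtomisticToContinuum.Crystallization.Theorems.OverbindingBudgetAffineTaylorCell
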